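import Summits.QuantumAdvantage.QuantumAdvantage.Theses.CompactnessLift
import Literature.Computability.Complexity.TimeBoundsProofs
import Literature.Computability.Complexity.CountingHierarchyProofs
import Literature.Computability.Complexity.TruncMapMachine
import Literature.Computability.Complexity.ClockedUniversalAcceptanceProofs

/-!
# Line `universal-clock-padding` (square-clock variant) for the crux `CompactnessPrinciple`
# (stmt-QuantumAdvantage-15270) — lead skeleton

HONEST LABEL. The crux is closed AS TYPED: the route types `BP·DTIME(n^c)` as
`bp (DTIME (fun n => n ^ c))`, whose coin string is free padding (refuters rreview-0816 /
rattack-15270-0, `Cruxes/CompactnessPrinciple/Disproof.lean`), so the crux follows from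

  `paddingCollapse : ∃ c₀, BPP ⊆ bp (DTIME (fun n => n ^ c₀))`

(zero quantum content; NOT progress on the intended CP′ over `BQTime`/`BPTime`).

The proof of `paddingCollapse` (Aaronson–van Melkebeek 2011 §3.3 "complete problem under
linear-time reductions ⇒ ONE exponent", pointed at `bp`; Arora–Barak 2009 Thm. 1.9 / §1.4.1):
for `L ∈ BPP` presented by `L' ∈ DTIME(n^k)` (machine `M'`) and coins `p`, the inner language is
the preimage of a SQUARE-CLOCKED universal acceptance language `U₂ ∈ P` (stub 1, a sibling of the
tree's `ClockedUA.U` iterating `|inst|²` guarded universal steps, so that no unary budget field is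
needed) under the linear-time instance map `W ↦ ⟨e, ⟨W, ε⟩⟩` (stub 2), where `e` codes the
pre-processor `M̂` = "truncate the coins to `p |x|`, then run `M'`" (stub 3: the tree's
`truncMapAux` wrapper with a polynomial clock, then `M'`; time `A(|x|) + |z|` on `⟨x, z⟩`); the
preimage lies in the fixed slice `DTIME(n^{max d 1})`, `d` the exponent of `U₂` (stub 4:
`TimeComputable.comp_holds` bookkeeping). On coin strings `z` of the prescribed length
`P |x| = p |x| + A |x| + h` the budget inequality `h · (A |x| + |z|) ≤ |inst|²` holds, so by
completeness/soundness of `U₂` and determinism (`TM2Std.outputs_unique`) the verdict is that of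
`L'` on `⟨x, z ↾ p|x|⟩`, whose success probability is the cylinder probability
(`uniformProb_take_of_le`) `≥ 2/3`.

Registered stubs (the only `sorry`s): `stub_squareClock`, `stub_instMap`, `stub_truncRun`,
`stub_preimage`. Proved here: `paddingCollapse`, `quadQ_subset_BQP`, `CompactnessPrinciple_of`.
-/

set_option linter.dupNamespace false

noncomputable section

namespace Summit.QuantumAdvantage.QuantumAdvantage.Cruxes.CompactnessPrinciple.UniversalClockPadding

open Polynomial
open Literature.Computability.Complexity Literature.Computability.Cryptography
open Summit.QuantumAdvantage.QuantumAdvantage.Theses.CompactnessLift (CompactnessPrinciple)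
open _root_.Computability (encodeBool)

/-! ### The four registered stubs -/

/-- **Stub 1 — square-clocked universal acceptance** (sibling of `ClockedUA.U`, Arora–Barak 2009
Thm. 1.9 / §1.4.1 with the clock `|inst|²` instead of `|inst|`): there is ONE language `U₂ ∈ P`
such that every machine `M` has a code `e` and an overhead constant `h` with
(completeness) if `M` outputs `[true]` on `w` within `t` steps and `h · t ≤ |⟨e, ⟨w, u⟩⟩|²` then
`⟨e, ⟨w, u⟩⟩ ∈ U₂`, and (soundness) if `⟨e, ⟨w, u⟩⟩ ∈ U₂` then `M` outputs `[true]` on `w`.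
Intended proof: `ClockedUniversalAcceptanceProofs.lean` verbatim with
`orbit₂ := (fun Z => F^[(X ^ 2).eval |fst Z|] Z) ∘ fanoutFn id ι` (`iterate_mem_FP_of_growth`
takes any clock polynomial), `e := ClockedUA.code M`, `h := haltAddr (ClockedUA.cM M)`,
`pflat_complete` / `pflat_sound` at round count `|inst|²`. -/
theorem stub_squareClock :
    ∃ U₂ : Language Bool, U₂ ∈ Classes.P ∧
      ∀ M : Turing.TM2ComputableAux Bool Bool, ∃ (e : List Bool) (h : ℕ),
        (∀ (w u : List Bool) (t : ℕ), M.OutputsWithin w [true] t →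
            h * t ≤ (boolPair e (boolPair w u)).length ^ 2 → boolPair e (boolPair w u) ∈ U₂) ∧
        (∀ w u : List Bool, boolPair e (boolPair w u) ∈ U₂ → ∃ t : ℕ, M.OutputsWithin w [true] t) := by
  sorry

/-- **Stub 2 — the instance map is linear time**: for every fixed code `e`, the map
`W ↦ ⟨e, ⟨W, ε⟩⟩ = dup e ++ 01 ++ dup W ++ 01` is computable within `a |W| + a` steps.
Intended proof: `StrCopy.dupT` (FST, `FST.timeComputable_eval`) ⨟ `RePairTM.aux`
(`rePair (dup W) = boolPair W []`, `4n + 5` steps) ⨟ the constant-front FST prepending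
`dup e ++ [false, true]`, glued by `TimeComputable.comp_holds` twice. -/
theorem stub_instMap (e : List Bool) :
    ∃ a : ℕ, TimeComputable id id (fun W : List Bool => boolPair e (boolPair W []))
      fun n => a * n + a := by
  sorry

/-- **Stub 3 — the truncating pre-processor, then `M'`**: if `M'` produces `out v` on every `v`
within `a |v|^k + a` steps, then some machine `M̂` produces, on every pair `⟨x, z⟩`, the word
`out ⟨x, z ↾ p(|x|)⟩` within `A(|x|) + |z|` steps for a polynomial `A`.
Intended proof: the clock `N : x ↦ ⟨x, 1^{p |x|}⟩` (`fanoutFn id (polyFn p) ∈ FP`), the tree's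
wrapper `truncMapAux N` (`outputsWithin_truncMapAux_boolPair`: `q |x| + 5|x| + 2 p|x| + |z|/2 + 11`
steps), then `M'` on the short word (`comp_outputsWithin`, `≤ a (2|x| + 2 + p |x|)^k + a`). -/
theorem stub_truncRun (M' : Turing.TM2ComputableAux Bool Bool) (out : List Bool → List Bool)
    (p : Polynomial ℕ) (a k : ℕ)
    (hM' : ∀ v : List Bool, M'.OutputsWithin v (out v) (a * v.length ^ k + a)) :
    ∃ (Mhat : Turing.TM2ComputableAux Bool Bool) (A : Polynomial ℕ), ∀ x z : List Bool,
      Mhat.OutputsWithin (boolPair x z) (out (boolPair x (z.take (p.eval x.length))))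
        (A.eval x.length + z.length) := by
  sorry

/-- **Stub 4 — linear-time preimages stay in the slice**: if `U ∈ DTIME(n^d)` and `ρ` is
computable in time `a n + a`, then `ρ⁻¹(U) = {W | ρ W ∈ U} ∈ DTIME(n^{max d 1})`.
Intended proof: `TimeComputable.comp_holds` with `s n := n + D (a n + a)`
(`OutputsWithin.length_le`, `D = machinePushBound`) and `t₂ n := c n^d + c` (monotone), then
`(s n)^d ≤ (1 + D a + D a)^d (n + 1)^d ≤ C (n^{max d 1} + 1)`. -/
theorem stub_preimage {U : Language Bool} {d : ℕ} (hU : U ∈ DTIME fun n => n ^ d)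
    {ρ : List Bool → List Bool} {a : ℕ} (hρ : TimeComputable id id ρ fun n => a * n + a) :
    {W : List Bool | ρ W ∈ U} ∈ DTIME fun n => n ^ max d 1 := by
  sorry

/-! ### Composition (proved) -/

/-- A deterministic machine has at most one output word on a given input (the `OutputsWithin`
form of `TM2Std.outputs_unique`; twin of `AvM.outputsWithin_unique`, not imported). -/
theorem outputsWithin_unique (M : Turing.TM2ComputableAux Bool Bool) {l l₁ l₂ : List Bool}
    {m₁ m₂ : ℕ} (h₁ : M.OutputsWithin l l₁ m₁) (h₂ : M.OutputsWithin l l₂ m₂) : l₁ = l₂ :=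
  List.map_injective_iff.2 M.outputAlphabet.symm.injective (TM2Std.outputs_unique M.tm h₁ h₂)

/-- Events that agree on the strings of the sampled length have the same probability. -/
theorem uniformProb_congr_len {m : ℕ} {E E' : Set (List Bool)}
    (h : ∀ r : List Bool, r.length = m → (r ∈ E ↔ r ∈ E')) :
    uniformProb m E = uniformProb m E' := by
  classical
  unfold uniformProb
  refine congrArg (fun s : Finset (List.Vector Bool m) => ((s.card : ℝ)) / 2 ^ m) ?_
  exact Finset.filter_congr fun r _ => h r.toList (by simp)

/-- The budget arithmetic: with `|z| = p + A + h` coins, `h (A + |z|) ≤ |⟨e, ⟨⟨x, z⟩, ε⟩⟩|²`. -/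
theorem budget_le (h A pn el n zl : ℕ) (hz : zl = pn + A + h) :
    h * (A + zl) ≤ (2 * el + 2 + (2 * (2 * n + 2 + zl) + 2 + 0)) ^ 2 := by
  have h1 : h ≤ zl := by omega
  have h2 : A + zl ≤ 2 * zl := by omega
  have h3 : 2 * zl ≤ 2 * el + 2 + (2 * (2 * n + 2 + zl) + 2 + 0) := by omega
  calc h * (A + zl) ≤ zl * (2 * zl) := Nat.mul_le_mul h1 h2
    _ ≤ (2 * el + 2 + (2 * (2 * n + 2 + zl) + 2 + 0)) *
          (2 * el + 2 + (2 * (2 * n + 2 + zl) + 2 + 0)) := Nat.mul_le_mul (by omega) h3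
    _ = (2 * el + 2 + (2 * (2 * n + 2 + zl) + 2 + 0)) ^ 2 := (sq _).symm

/-- **Padding collapse** (the typed content of the crux): ONE exponent `c₀` with
`BPP ⊆ bp (DTIME (fun n => n ^ c₀))`. See the module docstring. -/
theorem paddingCollapse : ∃ c₀ : ℕ, BPP ⊆ bp (DTIME fun n => n ^ c₀) := by
  obtain ⟨U₂, hU₂P, hU⟩ := stub_squareClock
  obtain ⟨d₀, hd₀⟩ := Set.mem_iUnion.1 hU₂P
  refine ⟨max d₀ 1, ?_⟩
  rintro L ⟨L', hL'P, p, hbp⟩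
  obtain ⟨k, hk⟩ := Set.mem_iUnion.1 hL'P
  obtain ⟨a, ha⟩ := hk
  obtain ⟨M', hM'⟩ := ha
  -- the clocked pre-processor `M̂`: truncate the coins to `p |x|`, then run `M'`
  obtain ⟨Mhat, A, hMhat⟩ :=
    stub_truncRun M' (fun v => encodeBool (L'.boolIndicator v)) p a k fun v => hM' v
  -- its code for the square-clocked universal machine, and the instance map
  obtain ⟨e, h, hcomplete, hsound⟩ := hU Mhat
  obtain ⟨a₁, hρ⟩ := stub_instMap e
  have hL'' : {W : List Bool | boolPair e (boolPair W []) ∈ U₂} ∈ DTIME fun n => n ^ max d₀ 1 :=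
    stub_preimage hd₀ hρ
  refine ⟨{W : List Bool | boolPair e (boolPair W []) ∈ U₂}, hL'', p + A + C h, fun x => ?_⟩
  set n := x.length with hn
  -- on coin strings of the prescribed length the verdict is that of `L'` on the truncated pair
  have key : ∀ z : List Bool, z.length = p.eval n + A.eval n + h →
      (boolPair e (boolPair (boolPair x z) []) ∈ U₂ ↔ boolPair x (z.take (p.eval n)) ∈ L') := by
    intro z hz
    have hrun : Mhat.OutputsWithin (boolPair x z)
        (encodeBool (L'.boolIndicator (boolPair x (z.take (p.eval n))))) (A.eval n + z.length) :=
      hMhat x z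
    constructor
    · intro hmem
      obtain ⟨t, ht⟩ := hsound (boolPair x z) [] hmem
      have heq := outputsWithin_unique Mhat ht hrun
      have hb : L'.boolIndicator (boolPair x (z.take (p.eval n))) = true := by
        have h1 : encodeBool (L'.boolIndicator (boolPair x (z.take (p.eval n)))) =
            [L'.boolIndicator (boolPair x (z.take (p.eval n)))] := rfl
        rw [h1] at heq
        simpa using heq.symm
      exact (Set.mem_iff_boolIndicator _ _).2 hb
    · intro hmem
      have hb : L'.boolIndicator (boolPair x (z.take (p.eval n))) = true :=
        (Set.mem_iff_boolIndicator _ _).1 hmem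
      have hrun' : Mhat.OutputsWithin (boolPair x z) [true] (A.eval n + z.length) := by
        rw [hb] at hrun
        exact hrun
      refine hcomplete (boolPair x z) [] (A.eval n + z.length) hrun' ?_
      simp only [length_boolPair, List.length_nil]
      exact budget_le h (A.eval n) (p.eval n) e.length n z.length hz
  -- the success probability is the cylinder probability of `L'`'s event
  have hx := hbp x
  have hle : p.eval n ≤ (p + A + C h).eval n := by simp only [eval_add, eval_C]; omega
  rw [← uniformProb_take_of_le hle] at hx
  refine hx.trans_eq (uniformProb_congr_len fun r hr => ?_)
  have hr' : r.length = p.eval n + A.eval n + h := by rw [hr]; simp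
  -- both memberships unfold (definitionally) to the two sides of `key`
  exact iff_congr (key r hr').symm Iff.rfl

/-- `QuadQ`, the route's inlined comprehension (verbatim), lies in `BQP` (an `O(n²)` encoder time
bound is the polynomial `C C * X ^ 2 + C C`; as in `Disproof.lean`). -/
theorem quadQ_subset_BQP :
    {L : Language Bool | ∃ F : QCircuitFamily cliffordT, F.IsOracleFree ∧
      (∃ C : ℕ, TimeComputable _root_.Computability.unaryEncodeNat (QCircuit.sigmaEncode (G := cliffordT))
        (fun n => (⟨n, F.ancillas n, F.circ n⟩ : Σ n m : ℕ, QCircuit cliffordT (n + m)))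
        (fun n => C * n ^ 2 + C)) ∧
      ∀ x, (x ∈ L → 2 / 3 ≤ F.acceptProbOn 0 x) ∧ (x ∉ L → F.acceptProbOn 0 x ≤ 1 / 3)} ⊆ BQP := by
  rintro L ⟨F, hfree, ⟨C, hT⟩, hgap⟩
  rw [ClassBQP.mem_BQP_iff]
  refine ⟨F, hfree, ⟨Polynomial.C C * Polynomial.X ^ 2 + Polynomial.C C, ?_⟩, hgap⟩
  exact hT.mono fun n => le_of_eq (by simp)

/-- **The line concludes the crux BY NAME** (the only `sorry`s of the file are the four stubs):
under `BQP ⊆ BPP`, `QuadQ ⊆ BQP ⊆ BPP ⊆ bp (DTIME n^{c₀})` with the ONE exponent of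
`paddingCollapse`. -/
theorem CompactnessPrinciple_of : CompactnessPrinciple := by
  intro hsub
  obtain ⟨c₀, hc₀⟩ := paddingCollapse
  exact ⟨c₀, fun L hL => hc₀ (hsub (quadQ_subset_BQP hL))⟩

end Summit.QuantumAdvantage.QuantumAdvantage.Cruxes.CompactnessPrinciple.UniversalClockPadding
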